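import Literature.NumberTheory.EllipticCurves.NodalReductionHondaTypeProofs
import Literature.NumberTheory.EllipticCurves.HondaStrongIsomorphismProofs
import Literature.NumberTheory.EllipticCurves.RootNumberAtkinLehnerSemistableProofs
import Literature.NumberTheory.DiophantineGeometry.LocalReductionHasMultiplicativeReductionAtProofs
import Mathlib.NumberTheory.Padics.HeightOneSpectrum
import HarnessLib

/-!
# Honda's theorem at a prime of multiplicative reduction: the formal group of `E/ℤ_p` is strongly
# isomorphic over `ℤ_p` to the formal group of `L(E, s)` (Honda 1968 Thm. 5, 1970 Thm. 9; proofs only)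

Topic `NumberTheory/EllipticCurves` (theorems only; no definition, no named fact). Sequel of
`HondaStrongIsomorphismProofs` (the same theorem at a good odd prime). For a globally minimal
elliptic curve `W/ℚ` and a prime `p` of MULTIPLICATIVE reduction — `p ∣ Δ_min(W)`, `p ∤ c₄`
(Silverman, *AEC*, VII.5.1(b)) — there is `ψ ∈ Xℤ_p⟦X⟧` with

  `log_{W ⊗ ℚ_p}(ψ(X)) = Σₙ aₙ(W) Xⁿ/n`   (`exists_padicInt_formalLog_subst_eq_lSeriesLog_of_dvd_of_not_dvd`),

`aₙ = aₙ(W)` the coefficients of Mathlib's `WeierstrassCurve.LFunction` — for EVERY prime `p`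
(no parity hypothesis). Both `log_W` (`NodalReductionHondaTypeProofs`: the formal group of the
nodal reduction is a Möbius conjugate of `𝔾̂_m`, so `[p] = ε·Frob` in `End(Ê)`) and
`ℓ = Σ aₙXⁿ/n` (here: the Euler factor `(1 − ε p⁻ˢ)⁻¹` at `p`, `ε = a_p = ±1`, gives
`a_{pm} = ε a_m`, so `pℓ − εℓ(Xᵖ) = Σ_{p ∤ n} p aₙXⁿ/n ∈ pℤ_p⟦X⟧`) are of the one-term Honda
type `p − εT`, equivalently of the tree's two-term type with `a = ε(1 + p)`; the SIGN is the same
on both sides because Mathlib's `a_p = 1` (split) / `−1` (non-split) is decided by the splitting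
over `𝔽_p` of the node-tangent polynomial `c₄T² + a₁c₄T − (54b₆ − 3b₂b₄ + a₂c₄)` of the minimal
model — independent of the minimal model (`hasSplitMultiplicativeReduction_iff_of_isMinimal_of_eq_smul`)
and read here on the global minimal model mod `p` (`hasSplitMultiplicativeReductionAt_iff_splits`) —
which is exactly the dichotomy `[p]˜ = Xᵖ` / `ĩ(Xᵖ)` of the formal group. Then Hazewinkel's
functional equation lemma (ii) (`norm_coeff_le_one_of_subst_eq`) makes `ψ = log_W⁻¹ ∘ ℓ` integral.
This is Honda, Osaka J. Math. 5 (1968), Thm. 5 ("if `C` has multiplicative reduction at `p` …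
`F` is of type `p − ε_pT`") and J. Math. Soc. Japan 22 (1970), Thm. 9, at one multiplicative prime;
it is the arithmetic input at the multiplicative primes of the finite-height route to Edixhoven's
integrality of the Manin constant (`NeronIsogenyScaling.lean`).

Also proved: `a_p(W) = ±1` and `a_{pm}(W) = a_p(W)·a_m(W)` at a multiplicative prime, from
`p ∣ Δ_min`, `p ∤ c₄` (`hasMultiplicativeReductionAt_of_dvd_of_not_dvd`,
`lFunction_prime_mul_of_dvd_of_not_dvd`).

## References

* T. Honda, *Formal groups and zeta-functions*, Osaka J. Math. 5 (1968), 199–213, Thm. 5.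
* T. Honda, *On the theory of commutative formal groups*, J. Math. Soc. Japan 22 (1970),
  213–246: Thm. 2 (p. 223), §6.2 Thm. 9 (pp. 240–241) (held: `paper:doi-10-2969-jmsj-02220213`).
  [Honda1970]
* J. H. Silverman, *The Arithmetic of Elliptic Curves*, 2nd ed. (2009), VII.5 Prop. 5.1(b),
  §C.16 (`L_v(T) = 1 ∓ T` at a multiplicative place). [SilvermanAEC2009]
* F. Diamond, J. Shurman, *A First Course in Modular Forms* (2005), §8.3, §8.8 (8.44).
  [DiamondShurman2005]
-/

noncomputable section

open scoped Classical

namespace WeierstrassCurve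

open PowerSeries Literature.RingTheory.FormalGroups Literature.NumberTheory.EllipticCurves
open ArithmeticFunction IsDedekindDomain NumberField Rat.HeightOneSpectrum

/-! ### Multiplicative reduction at `p ∣ Δ_min`, `p ∤ c₄`, and the splitting sign -/

section Reduction

variable (W : WeierstrassCurve ℚ) [W.IsElliptic] [W.IsGloballyMinimal] (v : HeightOneSpectrum (𝓞 ℚ))

/-- **Multiplicative reduction from `p ∣ Δ_min`, `p ∤ c₄`** (Silverman, *AEC*, VII.5.1(b)) for a
globally minimal `W`, at the place `v` over `p`. [cite: SilvermanAEC2009, VII.5 Prop. 5.1(b)] -/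
theorem hasMultiplicativeReductionAt_of_dvd_of_not_dvd
    (hΔ : ((primesEquiv v : ℕ) : ℤ) ∣ minimalDiscriminantInt W)
    (hc₄ : ¬ ((primesEquiv v : ℕ) : ℤ) ∣ (integralModelInt W).c₄) : W.HasMultiplicativeReductionAt v := by
  haveI : Fact (primesEquiv v : ℕ).Prime := ⟨(primesEquiv v).2⟩
  haveI := IsGloballyMinimal.isMinimal (W := W) v
  have hW : W.IsIntegralAt v := by
    show IsIntegral _ _
    infer_instance
  have hc : W.c₄ = ((integralModelInt W).c₄ : ℚ) := by
    conv_lhs => rw [← map_integralModelInt W]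
    rw [map_c₄, eq_intCast]
  -- `v(m) = 1 ↔ p ∤ m`, `v(m) < 1 ↔ p ∣ m` for `m ∈ ℤ` (`Rat.padicValuation_cast`)
  refine hasMultiplicativeReductionAt_of_valuation_c₄_eq_one hW ?_ ?_
  · rw [hc, (valuation_equiv_padicValuation v).eq_one_iff_eq_one, Rat.padicValuation_cast,
      Int.padicValuation_eq_one_iff]
    exact hc₄
  · rw [← cast_minimalDiscriminantInt, (valuation_equiv_padicValuation v).lt_one_iff_lt_one,
      Rat.padicValuation_cast, Int.padicValuation_lt_one_iff]
    exact hΔ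

/-- Splitting is invariant under a ring isomorphism of the coefficient field. [folklore] -/
theorem splits_map_ringEquiv_iff {k k' : Type*} [Field k] [Field k'] (e : k ≃+* k')
    (f : Polynomial k) : (f.map (e : k →+* k')).Splits ↔ f.Splits := by
  refine ⟨fun h ↦ ?_, fun h ↦ h.map _⟩
  have h' := h.map (e.symm : k' →+* k)
  have he : (e.symm : k' →+* k).comp (e : k →+* k') = RingHom.id k := by ext x; simp
  rwa [Polynomial.map_map, he, Polynomial.map_id] at h'

/-- **Split multiplicative reduction is read on the global minimal model mod `p`**: at a
multiplicative prime `p ∣ Δ_min`, `p ∤ c₄` of a globally minimal elliptic `W/ℚ`, `W` has split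
multiplicative reduction at the place `v` over `p` iff the node-tangent polynomial
`c₄T² + a₁c₄T − (54b₆ − 3b₂b₄ + a₂c₄)` of `integralModelInt W` splits over `𝔽_p` (model
independence, Silverman VII.1.3(b), plus `κ(v) ≃ ℤ/p`). [cite: SilvermanAEC2009, VII.5 Prop. 5.1(b) and VII.1 Prop. 1.3(b)] -/
theorem hasSplitMultiplicativeReductionAt_iff_splits
    (hΔ : ((primesEquiv v : ℕ) : ℤ) ∣ minimalDiscriminantInt W)
    (hc₄ : ¬ ((primesEquiv v : ℕ) : ℤ) ∣ (integralModelInt W).c₄) :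
    W.HasSplitMultiplicativeReductionAt v ↔
      (letI I := (integralModelInt W).map (Int.castRingHom (ZMod (primesEquiv v : ℕ)));
        (Polynomial.C I.c₄ * Polynomial.X ^ 2 + Polynomial.C (I.a₁ * I.c₄) * Polynomial.X
        - Polynomial.C (54 * I.b₆ - 3 * I.b₂ * I.b₄ + I.a₂ * I.c₄)).Splits) := by
  haveI : Fact (primesEquiv v : ℕ).Prime := ⟨(primesEquiv v).2⟩
  set O := v.adicCompletionIntegers ℚ with hO
  set Y := W.baseChange (v.adicCompletion ℚ) with hY
  haveI hmin : Y.IsMinimal O := IsGloballyMinimal.isMinimal (W := W) v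
  have hΔ0 : Y.Δ ≠ 0 := by
    rw [hY, baseChange, map_Δ]
    exact (map_ne_zero _).mpr W.isUnit_Δ.ne_zero
  obtain ⟨D, hD⟩ : ∃ D : VariableChange (v.adicCompletion ℚ), W.localMinimalModel v = D • Y := ⟨_, rfl⟩
  have hmult : Y.HasMultiplicativeReduction O :=
    (hasMultiplicativeReduction_iff_of_isMinimal_of_eq_smul O hD hΔ0).mp
      (W.hasMultiplicativeReductionAt_of_dvd_of_not_dvd v hΔ hc₄)
  unfold HasSplitMultiplicativeReductionAt
  haveI := hmult
  rw [hasSplitMultiplicativeReduction_iff_of_isMinimal_of_eq_smul O hD hΔ0,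
    hasSplitMultiplicativeReduction_iff]
  refine (exists_prop_of_true hmult).trans ?_
  rw [integralModel_adicCompletion_eq v W, nodalTangents_map, nodalTangents_map, Polynomial.map_map]
  -- `κ(v) ≃ ℤ/p`
  set e : IsLocalRing.ResidueField O ≃+* ZMod (primesEquiv v : ℕ) :=
    (IsLocalRing.ResidueField.mapEquiv (adicCompletionIntegers.padicIntEquiv v).toAlgEquiv.toRingEquiv).trans
      (PadicInt.residueField (p := (primesEquiv v : ℕ))) with he
  rw [← splits_map_ringEquiv_iff e, Polynomial.map_map]
  congr! 2
  exact RingHom.ext_int _ _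

/-- **`a_p(W) = 1` at a prime of split multiplicative reduction, `−1` at a non-split one**, in
terms of the global minimal model: `p ∣ Δ_min`, `p ∤ c₄`, and the node-tangent polynomial of
`integralModelInt W` mod `p` splits resp. does not (Silverman §C.16: `L_v(T) = 1 − T`, `1 + T`).
[cite: SilvermanAEC2009, §C.16 (definition of L_v(T)), PDF p. 390] -/
theorem lFunction_prime_eq_of_dvd_of_not_dvd (p : ℕ) [hp : Fact p.Prime]
    (hΔ : (p : ℤ) ∣ minimalDiscriminantInt W) (hc₄ : ¬ (p : ℤ) ∣ (integralModelInt W).c₄) :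
    W.LFunction p = (letI I := (integralModelInt W).map (Int.castRingHom (ZMod p));
      if (Polynomial.C I.c₄ * Polynomial.X ^ 2 + Polynomial.C (I.a₁ * I.c₄) * Polynomial.X
        - Polynomial.C (54 * I.b₆ - 3 * I.b₂ * I.b₄ + I.a₂ * I.c₄)).Splits
      then 1 else -1) := by
  obtain ⟨v, rfl⟩ : ∃ v : HeightOneSpectrum (𝓞 ℚ), (primesEquiv v : ℕ) = p :=
    ⟨primesEquiv.symm ⟨p, hp.out⟩, by rw [Equiv.apply_symm_apply]⟩
  have hmult := W.hasMultiplicativeReductionAt_of_dvd_of_not_dvd v hΔ hc₄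
  have hiff := W.hasSplitMultiplicativeReductionAt_iff_splits v hΔ hc₄
  split_ifs with hs
  · exact W.LFunction_apply_primesEquiv_of_hasSplitMultiplicativeReductionAt (hiff.mpr hs)
  · exact W.LFunction_apply_primesEquiv_of_hasMultiplicativeReductionAt_of_not_split hmult
      (fun h ↦ hs (hiff.mp h))

/-- `a_p(W) = 1 ∨ a_p(W) = −1` at a multiplicative prime. [cite: SilvermanAEC2009, §C.16 (definition of L_v(T)), PDF p. 390] -/
theorem lFunction_prime_eq_one_or_eq_neg_one_of_dvd_of_not_dvd (p : ℕ) [hp : Fact p.Prime]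
    (hΔ : (p : ℤ) ∣ minimalDiscriminantInt W) (hc₄ : ¬ (p : ℤ) ∣ (integralModelInt W).c₄) :
    W.LFunction p = 1 ∨ W.LFunction p = -1 := by
  rw [W.lFunction_prime_eq_of_dvd_of_not_dvd p hΔ hc₄]
  split_ifs
  · exact Or.inl rfl
  · exact Or.inr rfl

/-- **`a_{pᵏ}(W) = a_p(W)ᵏ` at a multiplicative prime** (Euler factor `(1 − a_pT)⁻¹`).
[cite: DiamondShurman2005, §8.8 (8.44)] -/
theorem lFunction_prime_pow_of_dvd_of_not_dvd (p : ℕ) [hp : Fact p.Prime]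
    (hΔ : (p : ℤ) ∣ minimalDiscriminantInt W) (hc₄ : ¬ (p : ℤ) ∣ (integralModelInt W).c₄) (k : ℕ) :
    W.LFunction (p ^ k) = W.LFunction p ^ k := by
  obtain ⟨v, rfl⟩ : ∃ v : HeightOneSpectrum (𝓞 ℚ), (primesEquiv v : ℕ) = p :=
    ⟨primesEquiv.symm ⟨p, hp.out⟩, by rw [Equiv.apply_symm_apply]⟩
  have hbad : ¬ W.HasGoodReductionAt v :=
    (W.hasMultiplicativeReductionAt_of_dvd_of_not_dvd v hΔ hc₄).not_hasGoodReductionAt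
  induction k using Nat.strong_induction_on with
  | _ k ih =>
    rcases k with _ | k
    · rw [pow_zero, pow_zero, W.isMultiplicative_LFunction.map_one]
    · rcases k with _ | k
      · rw [pow_one, pow_one]
      · rw [W.LFunction_apply_prime_pow_add_two v k, if_neg hbad, zero_mul, sub_zero,
          ih (k + 1) (by omega), ← pow_succ']

/-- **`a_{pm}(W) = a_p(W)·a_m(W)` for every `m` at a multiplicative prime** (complete
multiplicativity at a bad prime). [cite: DiamondShurman2005, §8.8 (8.44)] -/
theorem lFunction_prime_mul_of_dvd_of_not_dvd (p : ℕ) [hp : Fact p.Prime]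
    (hΔ : (p : ℤ) ∣ minimalDiscriminantInt W) (hc₄ : ¬ (p : ℤ) ∣ (integralModelInt W).c₄) (m : ℕ) :
    W.LFunction (p * m) = W.LFunction p * W.LFunction m := by
  have hmult := W.isMultiplicative_LFunction
  rcases Nat.eq_zero_or_pos m with rfl | hm
  · simp [ArithmeticFunction.map_zero]
  obtain ⟨k, m', hm', rfl⟩ := Nat.exists_eq_pow_mul_and_not_dvd hm.ne' p hp.out.ne_one
  have hcop : ∀ j, Nat.Coprime (p ^ j) m' := fun j ↦
    Nat.Coprime.pow_left j ((Nat.Prime.coprime_iff_not_dvd hp.out).mpr hm')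
  rw [show p * (p ^ k * m') = p ^ (k + 1) * m' by ring, hmult.map_mul_of_coprime (hcop (k + 1)),
    hmult.map_mul_of_coprime (hcop k), W.lFunction_prime_pow_of_dvd_of_not_dvd p hΔ hc₄,
    W.lFunction_prime_pow_of_dvd_of_not_dvd p hΔ hc₄, pow_succ']
  ring

end Reduction

/-! ### `ℓ = Σ aₙXⁿ/n` is of type `p − a_pT` at a multiplicative prime -/

section LSeries

variable (W : WeierstrassCurve ℚ) [W.IsElliptic] [W.IsGloballyMinimal] {p : ℕ} [hp : Fact p.Prime]

/-- **`ℓ = Σ aₙ(W)Xⁿ/n` is of Honda type `p − a_pT` at a multiplicative prime**, in the two-term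
form `hondaShift p (a_p(1+p)) ℓ ∈ ℤ_p⟦X⟧`: `pℓ − a_pℓ(Xᵖ) = Σ_{p∤n} p aₙXⁿ/n ∈ pℤ_p⟦X⟧` since
`a_{pm} = a_p a_m`. [Honda 1968, §4 / Thm. 5; Honda 1970, Thm. 8] [cite: Honda1970, Thm. 8] -/
theorem norm_coeff_hondaShift_lSeriesLog_le_one_of_dvd_of_not_dvd
    (hΔ : (p : ℤ) ∣ minimalDiscriminantInt W) (hc₄ : ¬ (p : ℤ) ∣ (integralModelInt W).c₄) (n : ℕ) :
    ‖PowerSeries.coeff n (hondaShift p ((W.LFunction p * (1 + p) : ℤ) : ℚ_[p])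
      (PowerSeries.mk fun k ↦ ((W.LFunction k : ℤ) : ℚ_[p]) / k))‖ ≤ 1 := by
  have hp0 : p ≠ 0 := hp.out.ne_zero
  set ℓ : ℚ_[p]⟦X⟧ := PowerSeries.mk fun k ↦ ((W.LFunction k : ℤ) : ℚ_[p]) / k with hℓ
  refine norm_coeff_hondaShift_le_one_of_oneTerm (W.lFunction_prime_eq_one_or_eq_neg_one_of_dvd_of_not_dvd p hΔ hc₄)
    (fun m ↦ ?_) n
  rw [map_sub, PowerSeries.coeff_C_mul, PowerSeries.coeff_C_mul, PowerSeries.coeff_expand]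
  by_cases hpm : p ∣ m
  · -- `m = p m'`: the coefficient vanishes
    obtain ⟨m', rfl⟩ := hpm
    rw [if_pos (dvd_mul_right p m'), Nat.mul_div_cancel_left m' hp.out.pos, hℓ, PowerSeries.coeff_mk,
      PowerSeries.coeff_mk, W.lFunction_prime_mul_of_dvd_of_not_dvd p hΔ hc₄ m']
    rcases Nat.eq_zero_or_pos m' with rfl | hm'
    · simp [ArithmeticFunction.map_zero]
    · have hm'0 : (m' : ℚ_[p]) ≠ 0 := by exact_mod_cast hm'.ne'
      have hpQ : (p : ℚ_[p]) ≠ 0 := by exact_mod_cast hp0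
      rw [show (p : ℚ_[p]) * (((W.LFunction p * W.LFunction m' : ℤ) : ℚ_[p]) / ((p * m' : ℕ) : ℚ_[p])) -
          ((W.LFunction p : ℤ) : ℚ_[p]) * (((W.LFunction m' : ℤ) : ℚ_[p]) / (m' : ℚ_[p])) = 0 by
        push_cast; field_simp; ring]
      rw [norm_zero]
      positivity
  · rw [if_neg hpm, mul_zero, sub_zero, hℓ, PowerSeries.coeff_mk, norm_mul, Padic.norm_p]
    have hm : ‖(m : ℚ_[p])‖ = 1 := by
      rw [Padic.norm_natCast_eq_one_iff]
      exact (Nat.Prime.coprime_iff_not_dvd hp.out).mpr hpm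
    rw [norm_div, hm, div_one]
    calc (p : ℝ)⁻¹ * ‖((W.LFunction m : ℤ) : ℚ_[p])‖ ≤ (p : ℝ)⁻¹ * 1 := by
          gcongr; exact Padic.norm_int_le_one _
      _ = (p : ℝ)⁻¹ := mul_one _

end LSeries

/-! ### Honda's strong isomorphism at a multiplicative prime -/

section Honda

variable {p : ℕ} [hp : Fact p.Prime]

/-- **Honda 1968 Thm. 5 / 1970 Thm. 9 at a prime of multiplicative reduction (strong isomorphism
over `ℤ_p`).** For a globally minimal elliptic `W/ℚ` and a prime `p ∣ Δ_min(W)`, `p ∤ c₄` (any `p`,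
also `p = 2`) there is `ψ ∈ Xℚ_p⟦X⟧` with `p`-integral coefficients such that
`log_{W ⊗ ℚ_p}(ψ) = Σₙ aₙ(W) Xⁿ/n`: the formal group of `W` over `ℤ_p` is strongly isomorphic over
`ℤ_p` to the formal group of its `L`-series. [cite: Honda1970, Thm. 9 (pp. 240–241) and Thm. 2 (p. 223)] -/
theorem exists_padicInt_formalLog_subst_eq_lSeriesLog_of_dvd_of_not_dvd (W : WeierstrassCurve ℚ)
    [W.IsElliptic] [W.IsGloballyMinimal] (hΔ : (p : ℤ) ∣ minimalDiscriminantInt W)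
    (hc₄ : ¬ (p : ℤ) ∣ (integralModelInt W).c₄) :
    ∃ ψ : ℚ_[p]⟦X⟧, PowerSeries.constantCoeff ψ = 0 ∧ (∀ n, ‖PowerSeries.coeff n ψ‖ ≤ 1) ∧
      (W.map (algebraMap ℚ ℚ_[p])).formalLog.subst ψ =
        PowerSeries.mk fun k ↦ ((W.LFunction k : ℤ) : ℚ_[p]) / k := by
  set log := (W.map (algebraMap ℚ ℚ_[p])).formalLog with hlog
  set ℓ : ℚ_[p]⟦X⟧ := PowerSeries.mk fun k ↦ ((W.LFunction k : ℤ) : ℚ_[p]) / k with hℓ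
  have hlog0 : PowerSeries.constantCoeff log = 0 := constantCoeff_formalLog _
  have hlog1 : PowerSeries.coeff 1 log = 1 := coeff_one_formalLog _
  have hunit : IsUnit (PowerSeries.coeff 1 log) := by rw [hlog1]; exact isUnit_one
  have hℓ0 : PowerSeries.constantCoeff ℓ = 0 := by
    rw [hℓ, ← PowerSeries.coeff_zero_eq_constantCoeff_apply, PowerSeries.coeff_mk, Nat.cast_zero, div_zero]
  have hsℓ : PowerSeries.HasSubst ℓ := PowerSeries.HasSubst.of_constantCoeff_zero' hℓ0
  set inv := log.substInvOfIsUnit hunit with hinv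
  have hsinv : PowerSeries.HasSubst inv := PowerSeries.HasSubst.substInvOfIsUnit log hunit
  set ψ := inv.subst ℓ with hψ
  have hψ0 : PowerSeries.constantCoeff ψ = 0 :=
    PowerSeries.constantCoeff_subst_eq_zero hℓ0 inv (PowerSeries.constantCoeff_substInvOfIsUnit log hunit)
  have hlogψ : log.subst ψ = ℓ := by
    rw [hψ, ← PowerSeries.subst_comp_subst_apply hsinv hsℓ, hinv,
      PowerSeries.subst_substInvOfIsUnit_right log hlog0 hunit, PowerSeries.subst_X hsℓ]
  refine ⟨ψ, hψ0, fun n ↦ ?_, hlogψ⟩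
  -- both `log` and `ℓ` are of Honda type `p − a_p(1+p)T + T²` (≡ `p − a_pT`)
  set V : WeierstrassCurve ℤ_[p] := (integralModelInt W).map (Int.castRingHom ℤ_[p]) with hV
  have hVc : V.map PadicInt.Coe.ringHom = W.map (algebraMap ℚ ℚ_[p]) := map_coe_integralModelInt W
  have hVt : V.map PadicInt.toZMod = (integralModelInt W).map (Int.castRingHom (ZMod p)) :=
    map_toZMod_integralModelInt W
  haveI hEc : (V.map PadicInt.Coe.ringHom).IsElliptic := by rw [hVc]; infer_instance
  have hΔt : (V.map PadicInt.toZMod).Δ = 0 := by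
    rw [hVt, map_Δ, eq_intCast, ZMod.intCast_zmod_eq_zero_iff_dvd]
    exact hΔ
  have hc₄t : (V.map PadicInt.toZMod).c₄ ≠ 0 := by
    rw [hVt, map_c₄, eq_intCast, Ne, ZMod.intCast_zmod_eq_zero_iff_dvd]
    exact hc₄
  have ha : ‖((W.LFunction p * (1 + p) : ℤ) : ℚ_[p])‖ ≤ 1 := Padic.norm_int_le_one _
  have hT₂ := W.norm_coeff_hondaShift_lSeriesLog_le_one_of_dvd_of_not_dvd hΔ hc₄
  have h1 : ‖PowerSeries.coeff 1 log‖ = 1 := by rw [hlog1, norm_one]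
  have hap := W.lFunction_prime_eq_of_dvd_of_not_dvd p hΔ hc₄
  have hT₁ : ∀ m, ‖PowerSeries.coeff m (hondaShift p ((W.LFunction p * (1 + p) : ℤ) : ℚ_[p]) log)‖ ≤ 1 := by
    intro m
    rw [hap, hlog, ← hVc]
    rw [← hVt] at hap ⊢
    split_ifs with hs
    · have h := V.norm_coeff_hondaShift_formalLog_le_one_of_nodal_split hΔt hc₄t hs m
      rwa [one_mul, show ((1 + p : ℤ) : ℚ_[p]) = ((1 + p : ℕ) : ℚ_[p]) by push_cast; ring]
    · have h := V.norm_coeff_hondaShift_formalLog_le_one_of_nodal_nonsplit hΔt hc₄t hs m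
      rwa [neg_one_mul, show ((-(1 + p : ℤ) : ℤ) : ℚ_[p]) = -((1 + p : ℕ) : ℚ_[p]) by push_cast; ring]
  exact norm_coeff_le_one_of_subst_eq ha hT₁ hT₂ h1 hψ0 hlogψ n

end Honda

end WeierstrassCurve
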